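import Mathlib
import Literature.Analysis.FluidPDE.VorticityCalculus
import Literature.Analysis.FluidPDE.TaoAveragedNondegeneracy
import Literature.Analysis.FluidPDE.TaoAveragedAngleSynthesis
import Summits.NavierStokesRegularity.NavierStokesRegularity.Theorems.ThreadingFluxHorizonTowerDefs
import Summits.NavierStokesRegularity.NavierStokesRegularity.Theorems.ThreadingFluxHorizonBlowdownScaling
import HarnessLib

/-!
# Crux `PoloidalLiouville` (stmt-NavierStokesRegularity-1222, W1), crux idea «horizon-threading-tower» (ns-idea-15):
# `λ² Loc₂` AND THE HEAD TERM IN BLOW-DOWN VARIABLES — layer (C) of the programme for `OrderTwoHorizonLawBlowdown`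

Support file (`--supports stmt-NavierStokesRegularity-1222`, helper).  Experiment cell `ns-wall-extremal`, width hand
ns-wall-eng-4 g4 (director-ns ruling 02:19:01Z (b)).  0 kit.  Vocabulary: `loc2`, `head`, `radialVirial` of the horizon card's
Theorems-side twin `ThreadingFluxHorizonTowerDefs`; the scaling lemmas of layer (B) `ThreadingFluxHorizonBlowdownScaling`.

The two sides of eng-4 g3's `HorizonTower.secondJetHeadForm` (p676921),
`∂ₜ²F(t₀, x) = Loc₂[u(t₀)](x) − ⟪curl u(t₀) x, ∇(radialVirial (head u(t₀) p(t₀)) x₀)(x)⟫`,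
evaluated at a blow-down point `x = x₀ + c z` and multiplied by `c²`, in terms of the rescaled data `W y = w (x₀ + c y)`,
`Q y = q (x₀ + c y)` (`w = u t₀`, `q = p t₀`, any `c ≠ 0`):

* `Scaling.loc2_affine` — with `Ω = curl W`, `Λ = W × Ω`:
  `c² · Loc₂[w](x₀ + c z) = ⟪z, curl(Λ × Ω) + curl(W × curl Λ)⟫(z)` (`= ‖z‖⁻² 𝔏₂[W](z)`, the HORIZON term)
  ` + c⁻¹ · ⟪z, curl(ΔW × Ω) + curl(W × ΔΩ) + Δ(curl Λ)⟫(z) + c⁻² · ⟪z, Δ(ΔΩ)⟫(z)` (the VISCOUS terms, down by `c⁻¹`, `c⁻²`);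
* `Scaling.headTerm_affine` — `⟪curl w, ∇(radialVirial (head w q) x₀)⟫(x₀ + c z) = c⁻² · ⟪curl W z, ∇(radialVirial (head W Q) 0)(z)⟫`
  (the radial virial is scale invariant: `(radialVirial B x₀) ∘ A = radialVirial (B ∘ A) 0`).

So `c² ∂ₜ²F(t₀, x₀ + c z) = ‖z‖⁻² 𝔏₂[W](z) + O(c⁻¹)·(jets of W) − ⟪curl W z, ∇(radialVirial (head W Q) 0)(z)⟫`, ready for the
limit `c = λₖ → ∞` of layer (D) (jet convergence of layer (A); the head term tends to `⟪curl U, ∇(r∂ᵣ(P₀ + s₀ log r + |U|²/2))⟫ = 0`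
for degree-0 homogeneous `U`, `P₀`).  Proof: the inverse scaling forms of layer (B) (`curl f ∘ A = c⁻¹ curl(f∘A)`,
`Δ f ∘ A = c⁻² Δ(f∘A)`, `∇`, `D`) pushed through the nested products with the bilinearity of `×`, `curl_add`/`curl_const_smul`,
`ContDiffAt.laplacian_add`/`laplacian_smul`; smoothness bookkeeping (`contDiff_laplacian`, `contDiff_cross_of`, `contDiff_curl_top`).

HONEST FRAME: pure calculus; `PoloidalLiouville` (1222) and NS regularity stay OPEN.
-/

-- the summit and its single problem share the name (D-0017 nested layout)
set_option linter.dupNamespace false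

noncomputable section

namespace Summit.NavierStokesRegularity.NavierStokesRegularity.Theorems.PoloidalLiouville.HorizonTower

open Set Function Filter Topology Metric
open scoped Topology RealInnerProductSpace Laplacian ContDiff
open Literature.Analysis.FluidPDE

namespace Scaling

/-- Smoothness of the Laplacian of a smooth map (`Δf = T ∘ D(Df)` with `T` a fixed continuous linear map). -/
theorem contDiff_laplacian {F : Type*} [NormedAddCommGroup F] [NormedSpace ℝ F] {f : E3 → F}
    (hf : ContDiff ℝ (⊤ : ℕ∞) f) : ContDiff ℝ (⊤ : ℕ∞) (Δ f) := by
  set e : OrthonormalBasis (Fin 3) ℝ E3 := EuclideanSpace.basisFun (Fin 3) ℝ with he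
  set T : (E3 →L[ℝ] E3 →L[ℝ] F) →L[ℝ] F :=
    ∑ i, (ContinuousLinearMap.apply ℝ F (e i)).comp (ContinuousLinearMap.apply ℝ (E3 →L[ℝ] F) (e i)) with hT
  have hΔ : Δ f = fun y => T (fderiv ℝ (fderiv ℝ f) y) := by
    rw [InnerProductSpace.laplacian_eq_iteratedFDeriv_orthonormalBasis f e]
    funext y
    simp only [hT, sum_apply, ContinuousLinearMap.comp_apply, ContinuousLinearMap.apply_apply]
    exact Finset.sum_congr rfl fun i _ => by rw [iteratedFDeriv_two_apply]; rfl
  rw [hΔ]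
  have h1 : ContDiff ℝ (⊤ : ℕ∞) (fderiv ℝ f) := hf.fderiv_right (m := (⊤ : ℕ∞)) (by norm_cast)
  have h2 : ContDiff ℝ (⊤ : ℕ∞) (fderiv ℝ (fderiv ℝ f)) := h1.fderiv_right (m := (⊤ : ℕ∞)) (by norm_cast)
  exact T.contDiff.comp h2

/-- Smoothness of the cross product of smooth fields. -/
theorem contDiff_cross_of {f g : E3 → E3} {n : WithTop ℕ∞} (hf : ContDiff ℝ n f) (hg : ContDiff ℝ n g) :
    ContDiff ℝ n (fun y => cross (f y) (g y)) := by
  have h := crossCLM.isBoundedBilinearMap.contDiff.comp (hf.prodMk hg)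
  simpa only [Function.comp_def, crossCLM_apply] using h

/-- Smoothness of the curl of a smooth field. -/
theorem contDiff_curl_top {f : E3 → E3} (hf : ContDiff ℝ (⊤ : ℕ∞) f) : ContDiff ℝ (⊤ : ℕ∞) (curl f) :=
  contDiff_curl (n := ⊤) (by exact_mod_cast hf)

variable {w : E3 → E3} {x₀ : E3} {c : ℝ}

/-- **`λ² Loc₂` IN BLOW-DOWN VARIABLES.**  For a smooth field `w`, a centre `x₀`, a scale `c ≠ 0` and the rescaled field
`W y = w (x₀ + c y)` with `Ω = curl W`, `Λ = W × Ω`: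
`c² · Loc₂[w](x₀ + c z) = ⟪z, curl(Λ × Ω) + curl(W × curl Λ)⟫(z)`
` + c⁻¹ · ⟪z, curl(ΔW × Ω) + curl(W × ΔΩ) + Δ(curl Λ)⟫(z) + c⁻² · ⟪z, Δ(ΔΩ)⟫(z)` —
the leading bracket is `‖z‖⁻² 𝔏₂[W](z)`, the rest are the viscous terms, down by `c⁻¹`, `c⁻²`. -/
theorem loc2_affine (hw : ContDiff ℝ (⊤ : ℕ∞) w) (x₀ : E3) (hc : c ≠ 0) (z : E3) :
    c ^ 2 * loc2 w x₀ (x₀ + c • z)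
      = inner ℝ z
          (curl (fun y => cross (cross (w (x₀ + c • y)) (curl (fun y => w (x₀ + c • y)) y))
              (curl (fun y => w (x₀ + c • y)) y)) z
            + curl (fun y => cross (w (x₀ + c • y))
              (curl (fun s => cross (w (x₀ + c • s)) (curl (fun y => w (x₀ + c • y)) s)) y)) z)
        + c⁻¹ * inner ℝ z
          (curl (fun y => cross ((Δ (fun y => w (x₀ + c • y))) y) (curl (fun y => w (x₀ + c • y)) y)) z
            + curl (fun y => cross (w (x₀ + c • y)) ((Δ (curl (fun y => w (x₀ + c • y)))) y)) z
            + (Δ (curl (fun s => cross (w (x₀ + c • s)) (curl (fun y => w (x₀ + c • y)) s)))) z)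
        + (c⁻¹) ^ 2 * inner ℝ z ((Δ (Δ (curl (fun y => w (x₀ + c • y))))) z) := by
  have hc2 : c * c ≠ 0 := mul_ne_zero hc hc
  /- the cast of characters: original fields and their rescalings -/
  set W : E3 → E3 := fun y => w (x₀ + c • y) with hW
  set Ω : E3 → E3 := curl W with hΩ
  set Λ : E3 → E3 := fun y => cross (W y) (Ω y) with hΛ
  set vort : E3 → E3 := curl w with hvort
  set lam : E3 → E3 := fun x => cross (w x) (vort x) with hlam
  set a : E3 → E3 := fun x => lam x + (Δ w) x with ha
  set N : E3 → E3 := fun x => curl lam x + (Δ vort) x with hN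
  set F₁ : E3 → E3 := fun x => cross (a x) (vort x) with hF₁
  set F₂ : E3 → E3 := fun x => cross (w x) (N x) with hF₂
  -- smoothness
  have hWs : ContDiff ℝ (⊤ : ℕ∞) W := contDiff_comp_affine hw x₀ c
  have hΩs : ContDiff ℝ (⊤ : ℕ∞) Ω := contDiff_curl_top hWs
  have hΛs : ContDiff ℝ (⊤ : ℕ∞) Λ := contDiff_cross_of hWs hΩs
  have hvorts : ContDiff ℝ (⊤ : ℕ∞) vort := contDiff_curl_top hw
  have hlams : ContDiff ℝ (⊤ : ℕ∞) lam := contDiff_cross_of hw hvorts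
  have hΔws : ContDiff ℝ (⊤ : ℕ∞) (Δ w) := contDiff_laplacian hw
  have has : ContDiff ℝ (⊤ : ℕ∞) a := hlams.add hΔws
  have hΔωs : ContDiff ℝ (⊤ : ℕ∞) (Δ vort) := contDiff_laplacian hvorts
  have hNs : ContDiff ℝ (⊤ : ℕ∞) N := (contDiff_curl_top hlams).add hΔωs
  have hF₁s : ContDiff ℝ (⊤ : ℕ∞) F₁ := contDiff_cross_of has hvorts
  have hF₂s : ContDiff ℝ (⊤ : ℕ∞) F₂ := contDiff_cross_of hw hNs
  have hΔWs : ContDiff ℝ (⊤ : ℕ∞) (Δ W) := contDiff_laplacian hWs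
  have hΔΩs : ContDiff ℝ (⊤ : ℕ∞) (Δ Ω) := contDiff_laplacian hΩs
  have hcurlΛs : ContDiff ℝ (⊤ : ℕ∞) (curl Λ) := contDiff_curl_top hΛs
  -- handy differentiability / `C²` facts
  have D : ∀ {f : E3 → E3}, ContDiff ℝ (⊤ : ℕ∞) f → Differentiable ℝ f := fun hf => hf.differentiable (by simp)
  have C2 : ∀ {f : E3 → E3}, ContDiff ℝ (⊤ : ℕ∞) f → ∀ y, ContDiffAt ℝ 2 f y :=
    fun hf y => (hf.of_le (by norm_cast)).contDiffAt
  /- (p1/e1) `curl w ∘ A = c⁻¹ Ω`, (p2) `(Δw) ∘ A = c⁻² ΔW` -/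
  have p1 : ∀ y, vort (x₀ + c • y) = c⁻¹ • Ω y := fun y => curl_affine_inv (D hw) x₀ hc y
  have e1 : (fun y => vort (x₀ + c • y)) = fun y => c⁻¹ • Ω y := funext p1
  have p2 : ∀ y, (Δ w) (x₀ + c • y) = (c * c)⁻¹ • (Δ W) y :=
    fun y => laplacian_affine_inv (hw.of_le (by norm_cast)) x₀ hc y
  /- (p3/e3) `lam ∘ A = c⁻¹ Λ`, (p4) `(curl lam) ∘ A = c⁻² curl Λ`, (p5) `(Δ curl w) ∘ A = c⁻³ ΔΩ` -/
  have p3 : ∀ y, lam (x₀ + c • y) = c⁻¹ • Λ y := by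
    intro y
    show cross (w (x₀ + c • y)) (vort (x₀ + c • y)) = c⁻¹ • cross (W y) (Ω y)
    rw [p1 y, Tao2016.cross_smul_right]
  have e3 : (fun y => lam (x₀ + c • y)) = fun y => c⁻¹ • Λ y := funext p3
  have p4 : ∀ y, (curl lam) (x₀ + c • y) = (c * c)⁻¹ • curl Λ y := by
    intro y
    rw [curl_affine_inv (D hlams) x₀ hc y, e3, curl_const_smul ((D hΛs) y), smul_smul, mul_inv]
  have p5 : ∀ y, (Δ vort) (x₀ + c • y) = ((c * c)⁻¹ * c⁻¹) • (Δ Ω) y := by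
    intro y
    rw [laplacian_affine_inv (hvorts.of_le (by norm_cast)) x₀ hc y, e1,
      show (fun y => c⁻¹ • Ω y) = c⁻¹ • Ω from rfl, InnerProductSpace.laplacian_smul _ (C2 hΩs y), smul_smul]
  /- (p6/e6) `N ∘ A`, (p7) `a ∘ A` -/
  have p6 : ∀ y, N (x₀ + c • y) = (c * c)⁻¹ • curl Λ y + ((c * c)⁻¹ * c⁻¹) • (Δ Ω) y := by
    intro y
    show curl lam (x₀ + c • y) + (Δ vort) (x₀ + c • y) = _
    rw [p4 y, p5 y]
  have e6 : (fun y => N (x₀ + c • y)) = fun y => (c * c)⁻¹ • curl Λ y + ((c * c)⁻¹ * c⁻¹) • (Δ Ω) y := funext p6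
  have p7 : ∀ y, a (x₀ + c • y) = c⁻¹ • Λ y + (c * c)⁻¹ • (Δ W) y := by
    intro y
    show lam (x₀ + c • y) + (Δ w) (x₀ + c • y) = _
    rw [p3 y, p2 y]
  /- (e8) `F₁ ∘ A` and (e10) `F₂ ∘ A` as combinations of the blow-down fields -/
  have e8 : (fun y => F₁ (x₀ + c • y))
      = fun y => (c⁻¹ * c⁻¹) • cross (Λ y) (Ω y) + ((c * c)⁻¹ * c⁻¹) • cross ((Δ W) y) (Ω y) := by
    funext y
    show cross (a (x₀ + c • y)) (vort (x₀ + c • y)) = _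
    rw [p7 y, p1 y, Tao2016.cross_add_left, Tao2016.cross_smul_left,
      Tao2016.cross_smul_left, Tao2016.cross_smul_right, Tao2016.cross_smul_right, smul_smul, smul_smul]
  have e10 : (fun y => F₂ (x₀ + c • y))
      = fun y => (c * c)⁻¹ • cross (W y) (curl Λ y) + ((c * c)⁻¹ * c⁻¹) • cross (W y) ((Δ Ω) y) := by
    funext y
    show cross (w (x₀ + c • y)) (N (x₀ + c • y)) = _
    rw [p6 y, Tao2016.cross_add_right, Tao2016.cross_smul_right, Tao2016.cross_smul_right]
  /- differentiability of the pieces -/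
  have hd1 : ∀ y, DifferentiableAt ℝ (fun y => cross (Λ y) (Ω y)) y := fun y => (D (contDiff_cross_of hΛs hΩs)) y
  have hd2 : ∀ y, DifferentiableAt ℝ (fun y => cross ((Δ W) y) (Ω y)) y := fun y => (D (contDiff_cross_of hΔWs hΩs)) y
  have hd3 : ∀ y, DifferentiableAt ℝ (fun y => cross (W y) (curl Λ y)) y := fun y => (D (contDiff_cross_of hWs hcurlΛs)) y
  have hd4 : ∀ y, DifferentiableAt ℝ (fun y => cross (W y) ((Δ Ω) y)) y := fun y => (D (contDiff_cross_of hWs hΔΩs)) y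
  /- (e9) `curl F₁ (A z)`, (e11) `curl F₂ (A z)`, (e12) `(ΔN)(A z)` -/
  have hd1' : DifferentiableAt ℝ (fun y => (c⁻¹ * c⁻¹) • cross (Λ y) (Ω y)) z := (hd1 z).const_smul (c⁻¹ * c⁻¹)
  have hd2' : DifferentiableAt ℝ (fun y => ((c * c)⁻¹ * c⁻¹) • cross ((Δ W) y) (Ω y)) z := (hd2 z).const_smul ((c * c)⁻¹ * c⁻¹)
  have hd3' : DifferentiableAt ℝ (fun y => (c * c)⁻¹ • cross (W y) (curl Λ y)) z := (hd3 z).const_smul ((c * c)⁻¹)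
  have hd4' : DifferentiableAt ℝ (fun y => ((c * c)⁻¹ * c⁻¹) • cross (W y) ((Δ Ω) y)) z := (hd4 z).const_smul ((c * c)⁻¹ * c⁻¹)
  have e9 : curl F₁ (x₀ + c • z)
      = (c⁻¹ * (c⁻¹ * c⁻¹)) • curl (fun y => cross (Λ y) (Ω y)) z
        + (c⁻¹ * ((c * c)⁻¹ * c⁻¹)) • curl (fun y => cross ((Δ W) y) (Ω y)) z := by
    rw [curl_affine_inv (D hF₁s) x₀ hc z, e8, curl_add hd1' hd2',
      curl_const_smul (hd1 z), curl_const_smul (hd2 z), smul_add, smul_smul, smul_smul]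
  have e11 : curl F₂ (x₀ + c • z)
      = (c⁻¹ * (c * c)⁻¹) • curl (fun y => cross (W y) (curl Λ y)) z
        + (c⁻¹ * ((c * c)⁻¹ * c⁻¹)) • curl (fun y => cross (W y) ((Δ Ω) y)) z := by
    rw [curl_affine_inv (D hF₂s) x₀ hc z, e10, curl_add hd3' hd4',
      curl_const_smul (hd3 z), curl_const_smul (hd4 z), smul_add, smul_smul, smul_smul]
  have e12 : (Δ N) (x₀ + c • z)
      = ((c * c)⁻¹ * (c * c)⁻¹) • (Δ (curl Λ)) z + ((c * c)⁻¹ * ((c * c)⁻¹ * c⁻¹)) • (Δ (Δ Ω)) z := by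
    rw [laplacian_affine_inv (hNs.of_le (by norm_cast)) x₀ hc z, e6]
    have hA : ContDiffAt ℝ 2 ((c * c)⁻¹ • curl Λ) z := (C2 hcurlΛs z).const_smul ((c * c)⁻¹)
    have hB : ContDiffAt ℝ 2 (((c * c)⁻¹ * c⁻¹) • (Δ Ω)) z := (C2 hΔΩs z).const_smul ((c * c)⁻¹ * c⁻¹)
    have hfun : (fun y => (c * c)⁻¹ • curl Λ y + ((c * c)⁻¹ * c⁻¹) • (Δ Ω) y)
        = ((c * c)⁻¹ • curl Λ) + (((c * c)⁻¹ * c⁻¹) • (Δ Ω)) := by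
      funext y; simp only [Pi.add_apply, Pi.smul_apply]
    rw [hfun, hA.laplacian_add hB, InnerProductSpace.laplacian_smul _ (C2 hcurlΛs z),
      InnerProductSpace.laplacian_smul _ (C2 hΔΩs z), smul_add, smul_smul, smul_smul]
  /- assemble -/
  have hloc : loc2 w x₀ (x₀ + c • z)
      = inner ℝ (c • z) (curl F₁ (x₀ + c • z) + curl F₂ (x₀ + c • z) + (Δ N) (x₀ + c • z)) := by
    simp only [loc2, add_sub_cancel_left, hF₁, hF₂, hN, ha, hlam, hvort]
  rw [hloc, e9, e11, e12]
  simp only [inner_add_right, inner_smul_right, real_inner_smul_left, hΛ, hΩ, hW]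
  field_simp
  ring


variable {q : E3 → ℝ}

/-- **THE HEAD TERM IN BLOW-DOWN VARIABLES.**  With `B = head w q = q + |w|²/2` and the rescaled data `W y = w (x₀ + c y)`,
`Q y = q (x₀ + c y)` (`c ≠ 0`):  `⟪curl w, ∇(r∂ᵣB)⟫(x₀ + c z) = c⁻² · ⟪curl W z, ∇(radialVirial (head W Q) 0)(z)⟫` — the radial
virial is scale invariant (`(radialVirial B x₀) ∘ A = radialVirial (B ∘ A) 0`), each of `curl` and `∇` contributes `c⁻¹`. -/
theorem headTerm_affine (hw : ContDiff ℝ (⊤ : ℕ∞) w) (hq : ContDiff ℝ 2 q) (x₀ : E3) (hc : c ≠ 0) (z : E3) :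
    inner ℝ (curl w (x₀ + c • z)) (gradient (radialVirial (head w q) x₀) (x₀ + c • z))
      = (c⁻¹) ^ 2 * inner ℝ (curl (fun y => w (x₀ + c • y)) z)
          (gradient (radialVirial (head (fun y => w (x₀ + c • y)) (fun y => q (x₀ + c • y))) 0) z) := by
  set B : E3 → ℝ := head w q with hB
  have hBC : ContDiff ℝ 2 B := by
    have h1 : ContDiff ℝ 2 (fun x => ‖w x‖ ^ 2 / 2) := ((hw.of_le (by norm_cast)).norm_sq ℝ).div_const 2
    exact hq.add h1
  have hBd : Differentiable ℝ B := hBC.differentiable (by norm_cast)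
  have hgradBd : Differentiable ℝ (gradient B) := by
    have h := (hBC.fderiv_right (m := 1) (by norm_cast)).differentiable (by simp)
    exact (InnerProductSpace.toDual ℝ E3).symm.differentiable.comp h
  have hRd : Differentiable ℝ (radialVirial B x₀) := by
    unfold radialVirial
    exact (differentiable_id.sub_const x₀).inner ℝ hgradBd
  -- the radial virial is scale invariant
  have hBA : (fun y : E3 => B (x₀ + c • y)) = head (fun y => w (x₀ + c • y)) (fun y => q (x₀ + c • y)) := rfl
  have hRA : (fun y : E3 => radialVirial B x₀ (x₀ + c • y))
      = radialVirial (head (fun y => w (x₀ + c • y)) (fun y => q (x₀ + c • y))) 0 := by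
    funext y
    unfold radialVirial
    rw [add_sub_cancel_left, sub_zero, gradient_affine_inv hBd x₀ hc y, hBA, inner_smul_right, real_inner_smul_left,
      ← mul_assoc, inv_mul_cancel₀ hc, one_mul]
  rw [curl_affine_inv (hw.differentiable (by simp)) x₀ hc z, gradient_affine_inv hRd x₀ hc z, hRA, inner_smul_right,
    real_inner_smul_left]
  ring

end Scaling

end Summit.NavierStokesRegularity.NavierStokesRegularity.Theorems.PoloidalLiouville.HorizonTower

end
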